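import Summits.QuantumFields.BalabanUV.Beta.FP.AveragingJetLettersRooted

/-!
# `Beta/FP/AveragingJetLettersRootedStraight` — road «FP» (binder row D1), row **RHOA-6b′** companion: THE STRAIGHT INSTANCE of the generic rooted
# kernel IS RHOA-6b's `q̇` (`FP/AveragingJetLetters.qdot`) — a cross-check of the conventions (one-sided word, `n⁻⁵` weight, field letter at position `s`)

HONEST FRAMING (cell `pub-balaban`, β sub-cell, verbatim): discharging `BetaPertH` makes Bałaban's UV stability UNCONDITIONAL — a real constructive-QFT
result; it is NOT the continuum limit and NOT the Clay problem.  THIS MODULE is [folklore] finite bookkeeping: one counting identity between two of the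
cell's OWN model kernels (`AveragingJetLettersRooted.ker₁` at the rule-free block family and `AveragingJetLetters.qdot`), no road object, 0 estimates,
0 cite, no `def`.  «not in print; our bookkeeping».
HONEST DEPENDENCY: continuum YM on T⁴ ⇐ BetaPertH ∧ nine spine estimates (0/9 proved); BetaPertH ⇐ (D1) ∧ (D4) ∧ CAP+tail; G-an2-4 gates asym, D1 and NE2/3/4.

ABSOLUTE RULE (cell charter, verbatim): «No internally-minted statement may enter as a cited fact. Every hypothesis is either kernel-proved in this package or a
verbatim quotation of a PUBLISHED theorem with page reference. The manuscript(s) under audit are NOT citable for their own disputed steps — they are the thing under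
adjudication; programme-internal (2001/route/tribunal) claims are never citable.»

WHAT IS TYPED: `count_map_range` ([folklore] `count b′ ((range s).map f) = #{j < s : f j = b′}`) and **`ker₁_straight_eq_qdot`**: with ONE radial rule
(`σ = Unit`, probability `1`), the EMPTY radial word and straight labels = base points, the block family's majorant kernel of `AveragingJetLettersRooted` §2
equals RHOA-6b's kernel `qdot n μ y b′ b = dotCount∕n⁵` ENTRYWISE — both count the triples `((x′, s), j)`, `j < s`, with the background letter at
`n•y + x′ + j·e_μ = b′` and the field letter at `n•y + x′ + s·e_μ = b`.  So the rooted file's letters at `rad = []` are letters of the landed straight kernel,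
and a radial rule only PREPENDS letters to each word (RHOA-6b′'s `blkBg`).  NOT the comb ∕ S_D instances, NOT power counting, NOT hbook, NOT D1, NOT BetaPertH.
Provenance: cross-cell idle-seat kernel duty NE7b → β∕D1, unit `b2b-balaban-t4-ne7b-formalise-leaf-02` gen 22, 2026-08-21; companion of p245346; no existing file touched.
-/

noncomputable section

namespace Summit.QuantumFields.BalabanUV.Beta.FP.AveragingJetLettersRootedStraight

open Finset
open scoped BigOperators
open Literature.MathematicalPhysics.QuantumFieldTheory.Balaban1983to89.Beta.DyadicShell (Pt)
open Literature.MathematicalPhysics.QuantumFieldTheory.Balaban1983to89.Beta.AxialBlockWeights (idx pt)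
open Summit.QuantumFields.BalabanUV.Beta.FP.AveragingJetLetters (mem_idx_iff qdot dotCount dotFiber dotIdx dotMap filter_lt_range)
open Summit.QuantumFields.BalabanUV.Beta.FP.AveragingJetLettersRooted (ker₁ blkW blkFld blkBg)

/-! ## §3 The straight instance IS RHOA-6b's kernel `qdot` (cross-check of the conventions) -/

section Straight

variable {B : Type*} [DecidableEq B]

/-- [folklore] `count b' ((range s).map f) = #{j < s : f j = b'}`. -/
theorem count_map_range (f : ℕ → B) (b' : B) (s : ℕ) :
    ((List.range s).map f).count b' = ((Finset.range s).filter fun j => f j = b').card := by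
  induction s with
  | zero => simp
  | succ s ih =>
    rw [List.range_succ, List.map_append, List.count_append, ih, Finset.range_add_one, Finset.filter_insert]
    have hs : s ∉ (Finset.range s).filter (fun j => f j = b') := by simp
    by_cases h : f s = b'
    · rw [if_pos h, Finset.card_insert_of_notMem hs]
      simp [h]
    · rw [if_neg h]
      simp [h]

/-- **THE STRAIGHT INSTANCE IS RHOA-6b's `q̇`**: one rule, probability `1`, NO radial word, straight labels = base points ⟹
`ker₁ = AveragingJetLetters.qdot n μ y` entrywise (same one-sided convention, same `n⁻⁵`, same field position). [folklore] -/
theorem ker₁_straight_eq_qdot (n : ℕ) (μ : Fin 4) (y b' b : Pt) :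
    ker₁ (blkW n (fun _ : Unit => (1 : ℝ))) (blkFld n μ y) (blkBg n μ y (fun (_ : Unit) (_ _ : Pt) => ([] : List Pt)) id) b' b
      = qdot n μ y b' b := by
  classical
  unfold ker₁ blkW blkFld blkBg qdot dotCount
  simp only [List.nil_append, id, mul_one]
  rw [Finset.sum_filter, Fintype.sum_prod_type]
  simp only [Finset.univ_unique, Finset.sum_singleton]
  rw [div_eq_inv_mul]
  -- pull the constant `n⁻⁵` out of the indicator sum
  have hite : ∀ q : ↥(idx n), (if n • y + pt μ q.1 = b then ((n : ℝ) ^ 5)⁻¹ * ((((List.range q.1.2).map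
      fun j => n • y + pt μ (q.1.1, j)).count b' : ℕ) : ℝ) else 0)
      = ((n : ℝ) ^ 5)⁻¹ * (if n • y + pt μ q.1 = b then ((((Finset.range q.1.2).filter
          fun j => n • y + pt μ (q.1.1, j) = b').card : ℕ) : ℝ) else 0) := by
    intro q
    split_ifs with h
    · rw [count_map_range]
    · rw [mul_zero]
  simp_rw [hite]
  rw [← Finset.mul_sum]
  congr 1
  -- both sides count the triples `((x′, s), j)`, `j < s`, with `β` at `b′` (position `j`) and `φ` at `b` (position `s`)
  rw [Finset.sum_coe_sort (idx n) (fun q => if n • y + pt μ q = b then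
      ((((Finset.range q.2).filter fun j => n • y + pt μ (q.1, j) = b').card : ℕ) : ℝ) else 0)]
  rw [dotFiber, dotIdx, Finset.filter_filter, Finset.card_filter, Finset.sum_product]
  push_cast
  refine Finset.sum_congr rfl fun q hq => ?_
  have hs : q.2 ≤ n := (mem_idx_iff.mp hq).2.le
  split_ifs with h
  · rw [Finset.card_filter]
    push_cast
    rw [← filter_lt_range hs, Finset.sum_filter]
    refine Finset.sum_congr rfl fun j _ => ?_
    simp only [dotMap, h, Prod.mk.injEq, and_true]
    split_ifs <;> simp_all
  · symm
    refine Finset.sum_eq_zero fun j _ => ?_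
    simp only [dotMap, Prod.mk.injEq, h, and_false, ite_false]

end Straight

end Summit.QuantumFields.BalabanUV.Beta.FP.AveragingJetLettersRootedStraight

end
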